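import Mathlib.Algebra.Order.Floor.Semiring
import Mathlib.Analysis.Complex.Basic
import Mathlib.Topology.MetricSpace.Pseudo.Lemmas
import Mathlib.Topology.UniformSpace.HeineCantor
import Literature.Probability.RandomPlanarGeometry.AffineInterp
import Literature.Probability.RandomPlanarGeometry.Curve

/-!
# Curve upgrade, part 1b: a continuous approximate projection onto a nearby arc

Support file for the crux `HexConjecture` (stmt-CriticalPhenomena-0808, Duminil-Copin–Smirnov 2012
Conjecture 1), line `root-locality-replaces-loewner`, stub `stub_curveUpgrade` (ABSTRACT upgrade of
range convergence to curve convergence). Namespace `…RootLocality.Upgrade`.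

`exists_continuous_projection` (registered helper, stated for `ℂ`; `exists_continuous_projection'`
is the version for any pseudo-metric space): let `c, η : [0,1] → E` be curves such that every point
of `c` is within `ε` of the trace of `η`, `c` and `η` have `ε`-close endpoints, `η` has the
injectivity modulus "`dist (η u) (η v) ≤ 2ε + β ⟹ |u - v| ≤ τ`" and the continuity modulus
"`|u - v| ≤ τ ⟹ dist (η u) (η v) ≤ r`", with `β > 0`. Then there is a CONTINUOUS
`q : [0,1] → [0,1]` with `q 0 = 0`, `q 1 = 1` and `dist (c t) (η (q t)) ≤ ε + β + r` for all `t`.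

Construction: sample nearest points `p i` of `η` at the grid `i/N` of a uniform-continuity scale
`1/N` of `c` for `β` (forcing `p 0 = 0`, `p N = 1`), observe `|p (i+1) - p i| ≤ τ` (the two
`η`-points are `2ε + β`-close), and interpolate affinely (`affineInterp`, `AffineInterp.lean`):
on the `i`-th cell `q` stays within `τ` of `p i` while `c` stays within `β` of `c (i/N)`.
Folklore (Aizenman–Burchard 1999 §2 style bookkeeping); no named fact is used.
-/

noncomputable section

open Set
open scoped unitInterval

namespace Summit.CriticalPhenomena.SAWScalingLimit.Theorems.HexConjecture.RootLocality.Upgrade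

open Literature.Probability.RandomPlanarGeometry

variable {E : Type*} [PseudoMetricSpace E]

/-- A point of a segment `[a, b]` of reals (`lineMap a b s`, `0 ≤ s ≤ 1`) is within `|b - a|` of
`a` and lies between `min a b` and `max a b`. [folklore] -/
theorem lineMap_mem_and_dist {a b s : ℝ} (hs0 : 0 ≤ s) (hs1 : s ≤ 1) :
    dist (AffineMap.lineMap a b s) a ≤ |b - a| ∧ min a b ≤ AffineMap.lineMap a b s ∧
      AffineMap.lineMap a b s ≤ max a b := by
  rw [AffineMap.lineMap_apply_ring']
  refine ⟨?_, ?_, ?_⟩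
  · rw [Real.dist_eq, show s * (b - a) + a - a = s * (b - a) by ring, abs_mul, abs_of_nonneg hs0]
    exact mul_le_of_le_one_left (abs_nonneg _) hs1
  · rcases le_total a b with hab | hab
    · rw [min_eq_left hab]; nlinarith
    · rw [min_eq_right hab]; nlinarith
  · rcases le_total a b with hab | hab
    · rw [max_eq_right hab]; nlinarith
    · rw [max_eq_left hab]; nlinarith

/-- Every `x ∈ [0, 1]` lies in some cell `[j/N, (j+1)/N]`, `j < N` (`N ≥ 1`). [folklore] -/
theorem exists_cell {N : ℕ} (hN : 1 ≤ N) {x : ℝ} (hx0 : 0 ≤ x) (hx1 : x ≤ 1) :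
    ∃ j : ℕ, j < N ∧ (j : ℝ) ≤ N * x ∧ (N : ℝ) * x ≤ j + 1 := by
  have hNpos : (0 : ℝ) < N := by exact_mod_cast hN
  rcases lt_or_eq_of_le hx1 with hlt | rfl
  · refine ⟨⌊(N : ℝ) * x⌋₊, ?_, Nat.floor_le (by positivity), (Nat.lt_floor_add_one _).le⟩
    have h1 : ((⌊(N : ℝ) * x⌋₊ : ℕ) : ℝ) < N :=
      (Nat.floor_le (by positivity)).trans_lt (by nlinarith)
    exact_mod_cast h1
  · refine ⟨N - 1, Nat.sub_lt hN one_pos, ?_, ?_⟩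
    · rw [Nat.cast_sub hN]; simp
    · rw [Nat.cast_sub hN]; simp

/-- **Continuous approximate projection onto a nearby arc** (general pseudo-metric version of the
registered helper `exists_continuous_projection`; see the module docstring for the construction).
[folklore] -/
theorem exists_continuous_projection' (c η : Curve E) {ε β τ r : ℝ} (hβ : 0 < β)
    (hnear : ∀ t : I, ∃ u : I, dist (c t) (η u) ≤ ε)
    (h0 : dist (c 0) (η 0) ≤ ε) (h1 : dist (c 1) (η 1) ≤ ε)
    (hinj : ∀ u v : I, dist (η u) (η v) ≤ 2 * ε + β → dist u v ≤ τ)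
    (hosc : ∀ u v : I, dist u v ≤ τ → dist (η u) (η v) ≤ r) :
    ∃ q : I → I, Continuous q ∧ q 0 = 0 ∧ q 1 = 1 ∧ ∀ t, dist (c t) (η (q t)) ≤ ε + β + r := by
  have hε : 0 ≤ ε := dist_nonneg.trans h0
  -- uniform continuity scale of `c` for `β`
  obtain ⟨θ, hθ, hcu⟩ := Metric.uniformContinuous_iff.1
    (CompactSpace.uniformContinuous_of_continuous c.continuous) β hβ
  obtain ⟨n, hn⟩ := exists_nat_one_div_lt hθ
  set N : ℕ := n + 1 with hNdef
  have hN : 1 ≤ N := Nat.succ_le_succ (Nat.zero_le _)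
  have hNpos : (0 : ℝ) < N := by exact_mod_cast hN
  have hNθ : 1 / (N : ℝ) < θ := by simpa [hNdef] using hn
  -- grid points and sampled nearest points
  let g : ℕ → I := fun i ↦ projIcc 0 1 zero_le_one ((i : ℝ) / N)
  have hg : ∀ i, i ≤ N → ((g i : I) : ℝ) = i / N := fun i hi ↦ by
    have hmem : (i : ℝ) / N ∈ Icc (0 : ℝ) 1 :=
      ⟨by positivity, (div_le_one hNpos).2 (by exact_mod_cast hi)⟩
    simp [g, projIcc_of_mem zero_le_one hmem]
  let p : ℕ → I := fun i ↦
    if i = 0 then 0 else if N ≤ i then 1 else Classical.choose (hnear (g i))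
  have hp0 : p 0 = 0 := by simp [p]
  have hpN : p N = 1 := by simp [p, Nat.one_le_iff_ne_zero.1 hN]
  have hp : ∀ i, i ≤ N → dist (c (g i)) (η (p i)) ≤ ε := by
    intro i hi
    by_cases hi0 : i = 0
    · subst hi0
      have : g 0 = 0 := Subtype.ext (by rw [hg 0 (Nat.zero_le _)]; simp)
      rw [this, hp0]; exact h0
    by_cases hiN : N ≤ i
    · have hieq : i = N := le_antisymm hi hiN
      subst hieq
      have : g N = 1 := Subtype.ext (by rw [hg N le_rfl]; exact div_self hNpos.ne')
      rw [this, hpN]; exact h1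
    · simp only [p, hi0, hiN, if_false]
      exact Classical.choose_spec (hnear (g i))
  -- consecutive samples are `τ`-close
  have hgdist : ∀ i, i + 1 ≤ N → dist (g i) (g (i + 1)) < θ := by
    intro i hi
    rw [Subtype.dist_eq, hg i (Nat.le_of_succ_le hi), hg (i + 1) hi, Real.dist_eq]
    have : (i : ℝ) / N - (i + 1 : ℕ) / N = -(1 / N) := by push_cast; ring
    rw [this, abs_neg, abs_of_pos (by positivity)]
    exact hNθ
  have hstep : ∀ i, i + 1 ≤ N → dist (p i) (p (i + 1)) ≤ τ := by
    intro i hi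
    refine hinj _ _ ?_
    calc dist (η (p i)) (η (p (i + 1)))
        ≤ dist (η (p i)) (c (g i)) + dist (c (g i)) (c (g (i + 1))) +
            dist (c (g (i + 1))) (η (p (i + 1))) := dist_triangle4 _ _ _ _
      _ ≤ ε + β + ε :=
          add_le_add (add_le_add (by rw [dist_comm]; exact hp i (Nat.le_of_succ_le hi))
            (hcu (hgdist i hi)).le) (hp (i + 1) hi)
      _ = 2 * ε + β := by ring
  -- the affine interpolation of the samples
  let L : List ℝ := List.ofFn fun i : Fin (N + 1) ↦ ((p i : I) : ℝ)
  have hLlen : L.length = N + 1 := List.length_ofFn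
  have hLget : ∀ (i : ℕ) (hi : i < L.length), L[i] = ((p i : I) : ℝ) := fun i hi ↦
    List.getElem_ofFn hi
  let Q : ℝ → ℝ := fun x ↦ affineInterp L (N * x)
  have hQc : Continuous Q := (continuous_affineInterp L).comp (continuous_const.mul continuous_id)
  -- cellwise description of `Q`
  have hcell : ∀ x : I, ∃ j : ℕ, j < N ∧ dist (x : ℝ) (g j) ≤ 1 / N ∧
      dist (Q x) (p j) ≤ τ ∧ Q x ∈ Icc (0 : ℝ) 1 := by
    intro x
    obtain ⟨j, hjN, hj1, hj2⟩ := exists_cell hN x.2.1 x.2.2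
    have hjL : j + 1 < L.length := by rw [hLlen]; omega
    have hQx : Q x = AffineMap.lineMap ((p j : I) : ℝ) ((p (j + 1) : I) : ℝ) ((N : ℝ) * x - j) := by
      have := affineInterp_eq_lineMap L j hjL (s := (N : ℝ) * x) ⟨hj1, hj2⟩
      simpa [Q, hLget] using this
    obtain ⟨hd, hmin, hmax⟩ := lineMap_mem_and_dist (a := ((p j : I) : ℝ))
      (b := ((p (j + 1) : I) : ℝ)) (s := (N : ℝ) * x - j) (by linarith) (by linarith)
    refine ⟨j, hjN, ?_, ?_, ?_⟩
    · rw [hg j hjN.le, Real.dist_eq]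
      have e1 : (j : ℝ) / N ≤ x := by rw [div_le_iff₀ hNpos]; linarith
      have e2 : (x : ℝ) ≤ (j + 1 : ℝ) / N := by rw [le_div_iff₀ hNpos]; linarith
      have e3 : (j + 1 : ℝ) / N = j / N + 1 / N := by rw [add_div]
      have e4 : (0 : ℝ) ≤ 1 / N := by positivity
      rw [abs_le]; constructor <;> linarith
    · rw [hQx]
      refine hd.trans ?_
      have := hstep j hjN
      rwa [Subtype.dist_eq, Real.dist_eq, abs_sub_comm] at this
    · rw [hQx]
      exact ⟨(le_min (p j).2.1 (p (j + 1)).2.1).trans hmin,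
        hmax.trans (max_le (p j).2.2 (p (j + 1)).2.2)⟩
  -- the projection `q`
  refine ⟨fun t ↦ projIcc 0 1 zero_le_one (Q t), continuous_projIcc.comp
    (hQc.comp continuous_subtype_val), ?_, ?_, fun t ↦ ?_⟩
  · have hQ0 : Q 0 = 0 := by
      show affineInterp L (N * 0) = 0
      have h := affineInterp_natCast L 0 (by rw [hLlen]; omega)
      rw [Nat.cast_zero] at h
      rw [mul_zero, h, hLget, hp0]
      rfl
    apply Subtype.ext
    show ((projIcc 0 1 zero_le_one (Q ((0 : I) : ℝ)) : I) : ℝ) = ((0 : I) : ℝ)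
    rw [show ((0 : I) : ℝ) = (0 : ℝ) from rfl, hQ0, projIcc_of_mem zero_le_one ⟨le_rfl, zero_le_one⟩]
  · have hQ1 : Q 1 = 1 := by
      show affineInterp L (N * 1) = 1
      have h := affineInterp_natCast L N (by rw [hLlen]; omega)
      rw [mul_one, h, hLget, hpN]
      rfl
    apply Subtype.ext
    show ((projIcc 0 1 zero_le_one (Q ((1 : I) : ℝ)) : I) : ℝ) = ((1 : I) : ℝ)
    rw [show ((1 : I) : ℝ) = (1 : ℝ) from rfl, hQ1, projIcc_of_mem zero_le_one ⟨zero_le_one, le_rfl⟩]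
  · obtain ⟨j, hjN, hxg, hQp, hQmem⟩ := hcell t
    have hqt : ((projIcc 0 1 zero_le_one (Q t) : I) : ℝ) = Q t := by
      rw [projIcc_of_mem zero_le_one hQmem]
    have hpq : dist (p j) (projIcc 0 1 zero_le_one (Q t)) ≤ τ := by
      rw [Subtype.dist_eq, hqt, dist_comm]; exact hQp
    have htg : dist (c t) (c (g j)) < β := hcu (by rw [Subtype.dist_eq]; exact hxg.trans_lt hNθ)
    calc dist (c t) (η (projIcc 0 1 zero_le_one (Q t)))
        ≤ dist (c t) (c (g j)) + dist (c (g j)) (η (p j)) +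
            dist (η (p j)) (η (projIcc 0 1 zero_le_one (Q t))) := dist_triangle4 _ _ _ _
      _ ≤ β + ε + r := add_le_add (add_le_add htg.le (hp j hjN.le)) (hosc _ _ hpq)
      _ = ε + β + r := by ring

/-- **Continuous approximate projection onto a nearby arc** (registered helper of
`stub_curveUpgrade`, plane case): if every point of the curve `c` is within `ε` of the trace of the
curve `η`, the endpoints are `ε`-close, `η` has injectivity modulus `(2ε + β ↦ τ)` and continuity
modulus `(τ ↦ r)`, and `β > 0`, then some continuous `q : [0,1] → [0,1]` with `q 0 = 0`,
`q 1 = 1` has `dist (c t) (η (q t)) ≤ ε + β + r` for all `t`. [folklore] -/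
theorem exists_continuous_projection : ∀ (c η : Literature.Probability.RandomPlanarGeometry.Curve ℂ) (ε β τ r : ℝ), 0 < β → (∀ t : unitInterval, ∃ u : unitInterval, dist (c t) (η u) ≤ ε) → dist (c 0) (η 0) ≤ ε → dist (c 1) (η 1) ≤ ε → (∀ u v : unitInterval, dist (η u) (η v) ≤ 2 * ε + β → dist u v ≤ τ) → (∀ u v : unitInterval, dist u v ≤ τ → dist (η u) (η v) ≤ r) → ∃ q : unitInterval → unitInterval, Continuous q ∧ q 0 = 0 ∧ q 1 = 1 ∧ ∀ t, dist (c t) (η (q t)) ≤ ε + β + r := by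
  intro c η ε β τ r hβ hnear h0 h1 hinj hosc
  exact exists_continuous_projection' c η hβ hnear h0 h1 hinj hosc

end Summit.CriticalPhenomena.SAWScalingLimit.Theorems.HexConjecture.RootLocality.Upgrade
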